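import Summits.RiemannHypothesis.RiemannHypothesis.Theorems.SignConeConeMagnificationDesignSpineA

/-!
# Stub `stub_deficitOfDesign` of line `Sketch` for crux `SignCone.ConeMagnification` — spine B (file 2 of 3)
(item stmt-RiemannHypothesis-16303, route route-RiemannHypothesis-SignCone; `--supports`, registered sub-goal
`stub_deficitOfDesign_pollution`)

The pollution bound of the finite design spine (2001 W-MAG programme, proof of Thm 5.4, eq. (pollution)), over the
vocabulary of `SignConeConeMagnificationDesignDefs`:

* elementary facts on `τ_p`, `e₂`, the composite-mass and deficit summands; `S_z = Nat.primesLE z`; a `k ≥ 2`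
  coprime to `Π_{S_z} p` exceeds `z`; `Λ(p·k) = 0` for `p ∤ k`, `k ≥ 2`; summability of the `ρ`-type series from AX-A;
* the POLLUTION BOUND (`Design.sum_piZ_le`, registered here verbatim as `stub_deficitOfDesign_pollution`): for `c ≥ 0`
  with AX-A and AX-B and `z ≥ 2`, `Σ_{p ≤ z} π_z(p) ≤ (C_τ/τ_{z+1}) · Σ_n compMassTerm c n`, where
  `π_z(p) = √p Σ_{k ≥ 2, (k, Π_{S_z} q) = 1} c(pk)/(pk)` is the composite remainder of `√p ρ_{S_z}(p)`: each index
  `n = pk` is composite, not a prime power, with all prime factors other than `p` above `z`, so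
  `√p ≤ C_τ τ_p ≤ (C_τ/τ_{z+1}) e₂(n)` and distinct `p ≤ z` have disjoint pollution indices.

Adapted from the prior programme's kernel-checked stockroom file
`reserve/prior-2001/Prior/RiemannHypothesis/RiemannHypothesis/Rh_WMagnificationY1_MagDeficit.lean` (interface
structure replaced by explicit hypotheses; `primesUpTo z` is Mathlib's `Nat.primesLE z`; the pollution predicate is
folded into `Design.pollutedTerm`).
-/

noncomputable section

-- `Summit.RiemannHypothesis.RiemannHypothesis.…` repeats a namespace component by design (D-0017 layout).
set_option linter.dupNamespace false

open Finset

namespace Summit.RiemannHypothesis.RiemannHypothesis.Theorems.SignConeConeMagnification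

namespace Design

/-! ### Elementary facts about the pieces -/

-- adapted from reserve/prior-2001/Prior/RiemannHypothesis/RiemannHypothesis/Rh_WMagnificationY1_MagDeficit.lean (2001 programme)
/-- `τ_p ≥ 0` for `p ≥ 2`. [folklore] -/
theorem tauP_nonneg {p : ℕ} (hp : 2 ≤ p) : 0 ≤ tauP p := by
  have h1 : (1 : ℝ) ≤ Real.sqrt p := by
    rw [show (1 : ℝ) = Real.sqrt 1 by simp]
    exact Real.sqrt_le_sqrt (by exact_mod_cast hp.trans' (by norm_num))
  simp only [tauP]
  linarith

/-- `τ_p > 0` for `p ≥ 2`. [folklore] -/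
theorem tauP_pos {p : ℕ} (hp : 2 ≤ p) : 0 < tauP p := by
  have h1 : (1 : ℝ) < Real.sqrt p := by
    rw [show (1 : ℝ) = Real.sqrt 1 by simp]
    exact Real.sqrt_lt_sqrt (by norm_num) (by exact_mod_cast hp.trans_lt' (by norm_num))
  simp only [tauP]
  linarith

/-- `τ_p` is monotone in `p`. [folklore] -/
theorem tauP_mono {p q : ℕ} (hpq : p ≤ q) : tauP p ≤ tauP q := by
  have := Real.sqrt_le_sqrt (show (p : ℝ) ≤ q by exact_mod_cast hpq)
  simp only [tauP]
  linarith

/-- `e₂(n) ≥ 0` (all `τ_q ≥ 0` for primes `q`). [folklore] -/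
theorem eTwo_nonneg (n : ℕ) : 0 ≤ eTwo n := by
  refine Finset.sum_nonneg fun q hq => Finset.sum_nonneg fun q' hq' => ?_
  have hq2 : 2 ≤ q := (Nat.prime_of_mem_primeFactors hq).two_le
  have hq'2 : 2 ≤ q' := (Nat.prime_of_mem_primeFactors (Finset.mem_filter.1 hq').1).two_le
  exact mul_nonneg (tauP_nonneg hq2) (tauP_nonneg hq'2)

/-- The composite-mass summand is nonnegative for `c ≥ 0`. [folklore] -/
theorem compMassTerm_nonneg {c : ℕ → ℝ} (hc : ∀ n, 0 ≤ c n) (n : ℕ) :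
    0 ≤ compMassTerm c n := by
  unfold compMassTerm
  split
  · exact mul_nonneg (div_nonneg (hc n) (Nat.cast_nonneg n)) (eTwo_nonneg n)
  · exact le_refl 0

/-- The deficit summand is nonnegative. [folklore] -/
theorem deficitTerm_nonneg (c : ℕ → ℝ) (p : ℕ) : 0 ≤ deficitTerm c p := by
  unfold deficitTerm
  split
  · exact div_nonneg (le_max_right _ _) (Real.sqrt_nonneg _)
  · exact le_refl 0

/-! ### The prime deficit at the scale `1/2` (2001 W-MAG Thm 5.4) -/

section Deficit

variable {c : ℕ → ℝ}

/-- `S_z = {p ≤ z : p prime}` is nonempty for `z ≥ 2`. [folklore] -/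
theorem primesLE_nonempty {z : ℕ} (hz : 2 ≤ z) : (Nat.primesLE z).Nonempty :=
  ⟨2, Nat.mem_primesLE.mpr ⟨hz, Nat.prime_two⟩⟩

/-- a prime divisor of a `k` coprime to `Π_{S_z} p` exceeds `z`. [folklore] -/
theorem lt_of_prime_dvd_coprime {z k q : ℕ} (hq : q.Prime) (hqk : q ∣ k)
    (hcop : Nat.Coprime k (∏ p ∈ Nat.primesLE z, p)) : z < q := by
  by_contra h
  rw [not_lt] at h
  exact prime_not_dvd_of_coprime hq hcop (Nat.mem_primesLE.mpr ⟨h, hq⟩) hqk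

/-- `k ≥ 2` coprime to `Π_{S_z} p` forces `k > z` (its least prime factor already does). [folklore] -/
theorem lt_of_coprime_prod {z k : ℕ} (hk : 2 ≤ k)
    (hcop : Nat.Coprime k (∏ p ∈ Nat.primesLE z, p)) : z < k := by
  have hq : (Nat.minFac k).Prime := Nat.minFac_prime (by omega)
  have h1 : z < Nat.minFac k := lt_of_prime_dvd_coprime hq (Nat.minFac_dvd k) hcop
  exact h1.trans_le (Nat.minFac_le (by omega))

/-- a product `p·k` with `p` prime, `k ≥ 2`, `p ∤ k` is not a prime power. [folklore] -/
theorem not_isPrimePow_mul {p k : ℕ} (hp : p.Prime) (hk : 2 ≤ k) (hpk : ¬ p ∣ k) :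
    ¬ IsPrimePow (p * k) := by
  rintro ⟨r, j, hr, hj, hrj⟩
  have hrn : r.Prime := Nat.prime_iff.mpr hr
  have hq : (Nat.minFac k).Prime := Nat.minFac_prime (by omega)
  have hqk : Nat.minFac k ∣ k := Nat.minFac_dvd k
  have hqne : Nat.minFac k ≠ p := fun h => hpk (h ▸ hqk)
  have h1 : p ∣ r ^ j := by rw [hrj]; exact dvd_mul_right p k
  have h2 : Nat.minFac k ∣ r ^ j := by rw [hrj]; exact hqk.mul_left p
  have h3 : p = r := (Nat.prime_dvd_prime_iff_eq hp hrn).mp (hp.dvd_of_dvd_pow h1)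
  have h4 : Nat.minFac k = r := (Nat.prime_dvd_prime_iff_eq hq hrn).mp (hq.dvd_of_dvd_pow h2)
  exact hqne (h4.trans h3.symm)

/-- `Λ(p·k) = 0` for `p` prime, `k ≥ 2`, `p ∤ k` (two distinct prime factors). [folklore] -/
theorem vonMangoldt_mul_eq_zero {p k : ℕ} (hp : p.Prime) (hk : 2 ≤ k) (hpk : ¬ p ∣ k) :
    ArithmeticFunction.vonMangoldt (p * k) = 0 := by
  rw [ArithmeticFunction.vonMangoldt_apply, if_neg (not_isPrimePow_mul hp hk hpk)]

/-- generic summability of an `ite`-restricted `d(mk)/(mk)` series, from AX-A. [folklore] -/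
theorem summable_ite_dwt (hd : Summable fun n : ℕ => |dwt c n| / (n : ℝ))
    {m : ℕ} (hm : 0 < m) (Q : ℕ → Prop) [DecidablePred Q] :
    Summable (fun k : ℕ => if Q k then dwt c (m * k) / ((m * k : ℕ) : ℝ) else 0) := by
  have hinj : Function.Injective (fun k : ℕ => m * k) := fun k1 k2 h =>
    Nat.eq_of_mul_eq_mul_left hm h
  have hcomp : Summable (fun k : ℕ => |dwt c (m * k)| / ((m * k : ℕ) : ℝ)) :=
    (hd.comp_injective hinj).congr fun k => rfl
  refine Summable.of_abs (Summable.of_nonneg_of_le (fun k => abs_nonneg _)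
    (fun k => ?_) hcomp)
  split
  · rw [abs_div, Nat.abs_cast]
  · rw [abs_zero]
    positivity

/-- `π_z(p) ≥ 0` for `c ≥ 0`. [folklore] -/
theorem piZ_nonneg (hc : ∀ n, 0 ≤ c n) (z p : ℕ) : 0 ≤ piZ c z p := by
  refine mul_nonneg (Real.sqrt_nonneg _) (tsum_nonneg fun k => ?_)
  split
  · exact div_nonneg (hc _) (Nat.cast_nonneg _)
  · exact le_rfl

/-- under the `k ≥ 2` coprime condition, `c(pk) = d(pk)` (the `Λ` term vanishes). [folklore] -/
theorem c_eq_dwt_of_coprime {z p k : ℕ} (hp : p ∈ Nat.primesLE z)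
    (hk : 2 ≤ k) (hcop : Nat.Coprime k (∏ q ∈ Nat.primesLE z, q)) :
    c (p * k) = dwt c (p * k) := by
  have hpp : p.Prime := Nat.prime_of_mem_primesLE hp
  have hpndvd : ¬ p ∣ k := prime_not_dvd_of_coprime hpp hcop hp
  rw [dwt, vonMangoldt_mul_eq_zero hpp hk hpndvd, sub_zero]

/-! #### The pollution bound (2001 W-MAG eq. (pollution)) -/

/-- `C_τ ≥ 0`. [folklore] -/
theorem cTau_nonneg : 0 ≤ cTau := by
  have h := Real.one_lt_sqrt_two
  exact div_nonneg (by positivity) (by linarith)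

/-- `√p/τ_p ≤ C_τ` for `p ≥ 2`, i.e. `√p ≤ C_τ·τ_p` (2001 W-MAG eq. (pollution):
`√p/τ_p = 2√p/(√p−1) ≤ 2√2/(√2−1)`). [folklore] -/
theorem sqrt_le_cTau_mul_tauP {p : ℕ} (hp : 2 ≤ p) :
    Real.sqrt p ≤ cTau * tauP p := by
  have h2 : Real.sqrt 2 ≤ Real.sqrt p := Real.sqrt_le_sqrt (by exact_mod_cast hp)
  have h1 := Real.one_lt_sqrt_two
  rw [cTau, tauP, div_mul_eq_mul_div, le_div_iff₀ (by linarith)]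
  nlinarith [h1, h2]

/-- the single-pair lower bound for `e₂` (2001 W-MAG: `e₂(n) ≥ τ_{p₁(n)} τ_{p₂(n)}`). [folklore] -/
theorem eTwo_ge {p q n : ℕ} (hp : p.Prime) (hq : q.Prime) (hpq : p < q)
    (hpn : p ∣ n) (hqn : q ∣ n) (hn : n ≠ 0) : tauP p * tauP q ≤ eTwo n := by
  have hpmem : p ∈ n.primeFactors := Nat.mem_primeFactors.mpr ⟨hp, hpn, hn⟩
  have hqmem : q ∈ n.primeFactors.filter (fun q' => p < q') :=
    Finset.mem_filter.mpr ⟨Nat.mem_primeFactors.mpr ⟨hq, hqn, hn⟩, hpq⟩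
  calc tauP p * tauP q
      ≤ ∑ q' ∈ n.primeFactors.filter (fun q' => p < q'), tauP p * tauP q' := by
        refine Finset.single_le_sum (f := fun q' => tauP p * tauP q') (fun i hi => ?_) hqmem
        exact mul_nonneg (tauP_nonneg hp.two_le)
          (tauP_nonneg (Nat.prime_of_mem_primeFactors (Finset.mem_filter.mp hi).1).two_le)
    _ ≤ eTwo n := by
        rw [eTwo]
        refine Finset.single_le_sum
          (f := fun q => ∑ q' ∈ n.primeFactors.filter (fun q' => q < q'), tauP q * tauP q')
          (fun i hi => ?_) hpmem
        exact Finset.sum_nonneg fun j hj => mul_nonneg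
          (tauP_nonneg (Nat.prime_of_mem_primeFactors hi).two_le)
          (tauP_nonneg (Nat.prime_of_mem_primeFactors (Finset.mem_filter.mp hj).1).two_le)

/-- a polluted index determines its small prime `p` (uniqueness across `p ∈ S_z`). [folklore] -/
theorem polluted_not_two {z p p' n : ℕ} (hp' : p' ∈ Nat.primesLE z)
    (h : p ∣ n ∧ 2 ≤ n ∧ ¬ IsPrimePow n ∧ ∀ q ∈ n.primeFactors, q ≠ p → z < q)
    (hdvd : p' ∣ n) (hne : p' ≠ p) : False := by
  have hn0 : n ≠ 0 := by
    have := h.2.1; omega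
  have hmem : p' ∈ n.primeFactors :=
    Nat.mem_primeFactors.mpr ⟨Nat.prime_of_mem_primesLE hp', hdvd, hn0⟩
  exact absurd (h.2.2.2 p' hmem hne) (not_lt.mpr (Nat.le_of_mem_primesLE hp'))

/-- The pollution series of `p` at level `z` converges (it is dominated by the composite-mass series, AX-B). [folklore] -/
theorem summable_pollutedTerm (hc : ∀ n, 0 ≤ c n) (hB : Summable (compMassTerm c)) (z p : ℕ) :
    Summable (pollutedTerm c z p) := by
  refine Summable.of_nonneg_of_le (fun n => ?_) (fun n => ?_) hB
  · rw [pollutedTerm]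
    split
    · exact compMassTerm_nonneg hc n
    · exact le_rfl
  · rw [pollutedTerm]
    split
    · exact le_rfl
    · exact compMassTerm_nonneg hc n

/-- the per-prime pollution bound (2001 W-MAG eq. (pollution), single `p` slice). [folklore] -/
theorem piZ_le (hc : ∀ n, 0 ≤ c n) (hd : Summable fun n : ℕ => |dwt c n| / (n : ℝ))
    (hB : Summable (compMassTerm c)) {z p : ℕ} (hz : 2 ≤ z) (hp : p ∈ Nat.primesLE z) :
    piZ c z p ≤ (cTau / tauP (z + 1))
      * ∑' n : ℕ, pollutedTerm c z p n := by
  have hpp : p.Prime := Nat.prime_of_mem_primesLE hp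
  have hple : p ≤ z := Nat.le_of_mem_primesLE hp
  have htTpos : 0 < tauP (z + 1) := tauP_pos (by omega)
  set P : ℕ := ∏ q ∈ Nat.primesLE z, q with hP
  have hgnn : ∀ n : ℕ,
      0 ≤ cTau / tauP (z + 1) * pollutedTerm c z p n := by
    intro n
    refine mul_nonneg (div_nonneg cTau_nonneg htTpos.le) ?_
    rw [pollutedTerm]
    split
    · exact compMassTerm_nonneg hc n
    · exact le_rfl
  rw [piZ, ← tsum_mul_left, ← tsum_mul_left]
  refine Summable.tsum_le_tsum_of_inj (fun k : ℕ => p * k)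
    (fun k1 k2 h => Nat.eq_of_mul_eq_mul_left hpp.pos h)
    (fun n _ => hgnn n) (fun k => ?_) ?_ ?_
  · -- termwise comparison
    by_cases hcond : 2 ≤ k ∧ Nat.Coprime k P
    · obtain ⟨hk2, hcop⟩ := hcond
      have hpk : ¬ p ∣ k := prime_not_dvd_of_coprime hpp hcop hp
      have hnn : 2 ≤ p * k := by
        have := Nat.mul_le_mul hpp.two_le hk2; omega
      have hnpp : ¬ IsPrimePow (p * k) := not_isPrimePow_mul hpp hk2 hpk
      have hpol : p ∣ p * k ∧ 2 ≤ p * k ∧ ¬ IsPrimePow (p * k) ∧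
          ∀ q ∈ (p * k).primeFactors, q ≠ p → z < q := by
        refine ⟨dvd_mul_right p k, hnn, hnpp, fun q hq hqne => ?_⟩
        have hqp : q.Prime := Nat.prime_of_mem_primeFactors hq
        have hqdvd : q ∣ p * k := Nat.dvd_of_mem_primeFactors hq
        have hqk : q ∣ k := by
          rcases (Nat.Prime.dvd_mul hqp).mp hqdvd with h | h
          · exact absurd ((Nat.prime_dvd_prime_iff_eq hqp hpp).mp h) hqne
          · exact h
        exact lt_of_prime_dvd_coprime hqp hqk hcop
      rw [if_pos ⟨hk2, hcop⟩, pollutedTerm, if_pos hpol, compMassTerm, if_pos ⟨hnn, hnpp⟩]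
      -- √p · (c(pk)/(pk)) ≤ (C_τ/τ_{z+1}) · (c(pk)/(pk) · e₂(pk))
      have hq0 : (Nat.minFac k).Prime := Nat.minFac_prime (by omega)
      have hq0k : Nat.minFac k ∣ k := Nat.minFac_dvd k
      have hq0z : z < Nat.minFac k := lt_of_prime_dvd_coprime hq0 hq0k hcop
      have he2 : tauP p * tauP (Nat.minFac k) ≤ eTwo (p * k) :=
        eTwo_ge hpp hq0 (by omega) (dvd_mul_right p k) (hq0k.mul_left p) (by omega)
      have hsqrtp : Real.sqrt p ≤ cTau / tauP (z + 1) * eTwo (p * k) := by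
        have h1 : Real.sqrt p ≤ cTau * tauP p := sqrt_le_cTau_mul_tauP hpp.two_le
        have h3 : (1 : ℝ) ≤ tauP (Nat.minFac k) / tauP (z + 1) :=
          (one_le_div htTpos).mpr (tauP_mono (by omega))
        have h4 : cTau * tauP p ≤ cTau / tauP (z + 1) * (tauP p * tauP (Nat.minFac k)) := by
          calc cTau * tauP p = cTau * tauP p * 1 := by ring
            _ ≤ cTau * tauP p * (tauP (Nat.minFac k) / tauP (z + 1)) :=
                mul_le_mul_of_nonneg_left h3
                  (mul_nonneg cTau_nonneg (tauP_nonneg hpp.two_le))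
            _ = cTau / tauP (z + 1) * (tauP p * tauP (Nat.minFac k)) := by ring
        have h5 : cTau / tauP (z + 1) * (tauP p * tauP (Nat.minFac k))
            ≤ cTau / tauP (z + 1) * eTwo (p * k) :=
          mul_le_mul_of_nonneg_left he2 (div_nonneg cTau_nonneg htTpos.le)
        linarith
      have hcn : 0 ≤ c (p * k) / ((p * k : ℕ) : ℝ) :=
        div_nonneg (hc _) (Nat.cast_nonneg _)
      calc Real.sqrt p * (c (p * k) / ((p * k : ℕ) : ℝ))
          ≤ cTau / tauP (z + 1) * eTwo (p * k) * (c (p * k) / ((p * k : ℕ) : ℝ)) :=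
            mul_le_mul_of_nonneg_right hsqrtp hcn
        _ = cTau / tauP (z + 1) * (c (p * k) / ((p * k : ℕ) : ℝ) * eTwo (p * k)) := by
            ring
    · rw [if_neg hcond, mul_zero]
      exact hgnn (p * k)
  · -- Summable of the left series
    have hfe : (fun k : ℕ => Real.sqrt p *
        (if 2 ≤ k ∧ Nat.Coprime k P then c (p * k) / ((p * k : ℕ) : ℝ) else 0))
        = fun k : ℕ => Real.sqrt p *
        (if 2 ≤ k ∧ Nat.Coprime k P then dwt c (p * k) / ((p * k : ℕ) : ℝ) else 0) := by
      funext k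
      by_cases hcond : 2 ≤ k ∧ Nat.Coprime k P
      · rw [if_pos hcond, if_pos hcond, c_eq_dwt_of_coprime (c := c) hp hcond.1 hcond.2]
      · rw [if_neg hcond, if_neg hcond]
    rw [hfe]
    exact (summable_ite_dwt hd hpp.pos _).mul_left _
  · exact (summable_pollutedTerm hc hB z p).mul_left _

/-- summing eq. (pollution) over `p ≤ z`: `Π_z ≤ (C_τ/τ_{z+1}) Σ_{n comp} (c(n)/n)e₂(n)`. [folklore] -/
theorem sum_piZ_le (hc : ∀ n, 0 ≤ c n) (hd : Summable fun n : ℕ => |dwt c n| / (n : ℝ))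
    (hB : Summable (compMassTerm c)) {z : ℕ} (hz : 2 ≤ z) :
    ∑ p ∈ Nat.primesLE z, piZ c z p
      ≤ (cTau / tauP (z + 1)) * ∑' n : ℕ, compMassTerm c n := by
  have htTpos : 0 < tauP (z + 1) := tauP_pos (by omega)
  have h1 : ∑ p ∈ Nat.primesLE z, piZ c z p
      ≤ ∑ p ∈ Nat.primesLE z, (cTau / tauP (z + 1))
          * ∑' n : ℕ, pollutedTerm c z p n :=
    Finset.sum_le_sum fun p hp => piZ_le hc hd hB hz hp
  have h2 : ∑ p ∈ Nat.primesLE z, (cTau / tauP (z + 1))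
        * ∑' n : ℕ, pollutedTerm c z p n
      = (cTau / tauP (z + 1)) * ∑ p ∈ Nat.primesLE z,
          ∑' n : ℕ, pollutedTerm c z p n :=
    (Finset.mul_sum _ _ _).symm
  -- swap the finite and infinite sums, then bound pointwise by uniqueness
  have hswap : HasSum (fun n : ℕ => ∑ p ∈ Nat.primesLE z,
      pollutedTerm c z p n)
      (∑ p ∈ Nat.primesLE z,
        ∑' n : ℕ, pollutedTerm c z p n) :=
    hasSum_sum fun p _ => (summable_pollutedTerm hc hB z p).hasSum
  have h3 : ∑ p ∈ Nat.primesLE z,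
      ∑' n : ℕ, pollutedTerm c z p n
      ≤ ∑' n : ℕ, compMassTerm c n := by
    rw [← hswap.tsum_eq]
    refine Summable.tsum_le_tsum (fun n => ?_) hswap.summable hB
    by_cases hex : ∃ p ∈ Nat.primesLE z,
        p ∣ n ∧ 2 ≤ n ∧ ¬ IsPrimePow n ∧ ∀ q ∈ n.primeFactors, q ≠ p → z < q
    · obtain ⟨p₀, hp₀, hpol⟩ := hex
      rw [Finset.sum_eq_single_of_mem p₀ hp₀ (fun p hp hne => by
        rw [pollutedTerm]
        exact if_neg (fun hpol' => polluted_not_two hp₀ hpol' hpol.1 (Ne.symm hne)))]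
      · rw [pollutedTerm, if_pos hpol]
    · rw [Finset.sum_eq_zero fun p hp => by
        rw [pollutedTerm]
        exact if_neg fun hpol => hex ⟨p, hp, hpol⟩]
      exact compMassTerm_nonneg hc n
  calc ∑ p ∈ Nat.primesLE z, piZ c z p
      ≤ (cTau / tauP (z + 1)) * ∑ p ∈ Nat.primesLE z,
          ∑' n : ℕ, pollutedTerm c z p n := by
        rw [← h2]; exact h1
    _ ≤ (cTau / tauP (z + 1)) * ∑' n : ℕ, compMassTerm c n :=
        mul_le_mul_of_nonneg_left h3 (div_nonneg cTau_nonneg htTpos.le)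


end Deficit

end Design

/-! ### Registered sub-goal -/

/-- **Registered sub-goal `stub_deficitOfDesign_pollution`** (= `Design.sum_piZ_le`, 2001 W-MAG eq. (pollution) summed
over `p ≤ z`): for `c ≥ 0` with AX-A and AX-B and `z ≥ 2`, `Σ_{p ≤ z} π_z(p) ≤ (C_τ/τ_{z+1}) · Σ_n compMassTerm c n`.
[folklore] -/
theorem stub_deficitOfDesign_pollution :
    ∀ c : ℕ → ℝ, (∀ n, 0 ≤ c n) → Summable (fun n : ℕ => |Design.dwt c n| / (n : ℝ)) →
      Summable (Design.compMassTerm c) → ∀ z : ℕ, 2 ≤ z →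
        ∑ p ∈ Nat.primesLE z, Design.piZ c z p ≤
          Design.cTau / Design.tauP (z + 1) * ∑' n : ℕ, Design.compMassTerm c n :=
  fun _ hc hd hB _ hz => Design.sum_piZ_le hc hd hB hz

end Summit.RiemannHypothesis.RiemannHypothesis.Theorems.SignConeConeMagnification

end
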